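import Mathlib.AlgebraicGeometry.ZariskisMainTheorem
import Mathlib.AlgebraicGeometry.Morphisms.Proper
import Summits.ResolutionOfSingularities.ResolutionOfSingularities.Theorems.EquisingularLiftEquisingularLiftNatPushdownCover
import HarnessLib

/-!
# [OURS · L1 W4.5(b)] EL♮ `EquisingularLiftNat` (stmt-ResolutionOfSingularities-20038), line `sections` —
# helper H-L0a `pushdown_lift_of_nose`, part 6 = ORDER (R3): THE PACKAGED PUSHDOWN
# «proper + closed immersion on the special fibre ⇒ closed immersion (isomorphism if dominant)»

Helper file `--supports stmt-ResolutionOfSingularities-20038` (res-L1-w45b-plan-1 ORDERS 2026-08-27T05:49:16Z (R3)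
`isClosedImmersion_of_isClosedImmersion_specialFibre`; lead-2 RECONCILE 05:57:35Z «T-LEN withdrawn — R3 bypasses the
multiplicity bookkeeping»). Parts 1–5: `…NatPushdown` (p500010, Nakayama core), `…NatPushdownScheme` (p501971/p502697/p503206),
`…NatPushdownCover` (p503621). NOT a statement of any manuscript; OURS plumbing over Mathlib (Zariski's Main Theorem
`IsFinite.of_isProper_of_locallyQuasiFinite`, the open quasi-finite locus, `IsZariskiLocalAtTarget`).

Content:
* `isFinite_of_isProper_of_subsingleton_fibres` — a PROPER morphism whose fibres over a set `S ⊆ Y` are subsingletons, with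
  every non-empty closed subset of `Y` meeting `S`, is FINITE (quasi-finite at every point over `S` since such a point is its
  whole fibre; the quasi-finite locus is open and `f` is closed, so the locus is everything; then ZMT).
* `exists_mem_apply_eq_closedPoint_of_isClosedMap` — for `q : Y ⟶ Spec O` a closed map with `O` local, every non-empty
  closed subset of `Y` contains a point over the closed point (this is the «meets `S`» input with `S = q⁻¹(closed point)`).
* `isClosedImmersion_of_isProper_of_specialFibre` / `isIso_of_isProper_of_specialFibre` — **(R3)**: `q : Y ⟶ Spec O`
  universally closed, `O` local, `ϖ₀ ∈ 𝔪_O`; `f : X ⟶ Y` proper; «`f_k` is a closed immersion» in point + ring form —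
  `f` is injective over the closed point (fibres over `q⁻¹(closed point)` subsingleton) and `f♯` is `ϖ₀`-surjective on a
  chosen affine cover `V i` of `Y` — `⇒` `f` is a closed immersion; if moreover `f♯` is injective on the `V i`, an
  isomorphism. `…_of_isProper_comp` variants take `X` proper over `Spec O` and `q` separated instead (Mathlib
  `IsProper.of_comp`).

Honest scope: for `O` a DVR with uniformiser `ϖ₀` the ring-form hypothesis is exactly surjectivity of
`Γ(Y_k, V_k) → Γ(X_k, f_k⁻¹ V_k)` chart by chart, i.e. «`f_k` is a closed immersion»; the categorical dictionary
`IsClosedImmersion (pullback.map …) ↔ (point + ring form)` is NOT in this file. In CRUX-PLAN v3 §1.3 (nose case (N)) take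
`X := C`, `Y := C̄` (scheme-theoretic image in `ℙ³_O`, `f := toImage`, injective on charts by Mathlib
`Scheme.Hom.toImage_app_injective`), to get `C ≅ C̄`: a regular `O`-smooth embedded lift of `Σ`. [folklore]
-/

set_option linter.dupNamespace false -- mandated namespace `Summit.<Summit>.<Problem>` of this single-conjunct summit

noncomputable section

open CategoryTheory AlgebraicGeometry TopologicalSpace

universe u

namespace Summit.ResolutionOfSingularities.ResolutionOfSingularities.Cruxes.EquisingularLiftNat.Sections

variable {X Y : Scheme.{u}} (f : X ⟶ Y)

/-! ## Proper + subsingleton fibres over a cofinal set ⇒ finite (Zariski's Main Theorem) -/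

/-- A point which is alone in its fibre is a quasi-finite point (for `f` locally of finite type). [folklore] -/
theorem quasiFiniteAt_of_preimage_subsingleton [LocallyOfFiniteType f] (x : X)
    (hx : (f ⁻¹' {f x}).Subsingleton) : f.QuasiFiniteAt x := by
  rw [Scheme.Hom.quasiFiniteAt_iff_isOpen_singleton_asFiber]
  haveI : Subsingleton (f ⁻¹' {f x}) := hx.coe_sort
  haveI : Subsingleton (f.fiber (f x)) := (f.fiberHomeo (f x)).toEquiv.subsingleton
  have : ({f.asFiber x} : Set (f.fiber (f x))) = Set.univ :=
    Set.eq_univ_of_forall fun a => Subsingleton.elim a _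
  rw [this]
  exact isOpen_univ

/-- **Proper + subsingleton fibres over a set met by every non-empty closed subset ⇒ finite.** `f : X ⟶ Y` proper; `S ⊆ Y`
such that every fibre over a point of `S` has at most one point and every non-empty closed subset of `Y` meets `S`. Then
`f` is finite: the quasi-finite locus of `f` is open (Mathlib, via Zariski's Main Theorem) and contains `f⁻¹(S)`; its
closed complement has closed image disjoint from `S`, hence empty; so `f` is locally quasi-finite and proper, hence finite
(`IsFinite.of_isProper_of_locallyQuasiFinite`). [folklore] -/
theorem isFinite_of_isProper_of_subsingleton_fibres [IsProper f] (S : Set Y)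
    (hS : ∀ Z : Set Y, IsClosed Z → Z.Nonempty → ∃ y ∈ Z, y ∈ S)
    (hfib : ∀ y ∈ S, (f ⁻¹' {y}).Subsingleton) : IsFinite f := by
  have hqf : ∀ x : X, f x ∈ S → f.QuasiFiniteAt x := fun x hx =>
    quasiFiniteAt_of_preimage_subsingleton f x (hfib _ hx)
  have hlocus : f.quasiFiniteLocus = ⊤ := by
    refine top_le_iff.mp fun x _ => ?_
    by_contra hx
    have hZ : IsClosed (f '' ((f.quasiFiniteLocus : Set X)ᶜ)) :=
      f.isClosedMap _ f.quasiFiniteLocus.isOpen.isClosed_compl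
    obtain ⟨y, ⟨x', hx', rfl⟩, hyS⟩ := hS _ hZ ⟨f x, x, hx, rfl⟩
    exact hx' (hqf x' hyS)
  haveI : LocallyQuasiFinite f := (Scheme.Hom.quasiFiniteLocus_eq_top_iff f).mp hlocus
  exact IsFinite.of_isProper_of_locallyQuasiFinite f

/-! ## Points over the closed point of a local base -/

/-- For `q : Y ⟶ Spec O` a closed map with `O` local, every non-empty closed `Z ⊆ Y` contains a point over the closed
point of `Spec O` (the closed image `q(Z)` contains a point, hence its specialisation, the closed point). [folklore] -/
theorem exists_mem_apply_eq_closedPoint_of_isClosedMap {O : CommRingCat.{u}} [IsLocalRing O] (q : Y ⟶ Spec O)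
    (hq : IsClosedMap q) (Z : Set Y) (hZ : IsClosed Z) (hne : Z.Nonempty) :
    ∃ y ∈ Z, q y = IsLocalRing.closedPoint O := by
  obtain ⟨z, hz⟩ := hne
  have hmem : IsLocalRing.closedPoint O ∈ q '' Z :=
    (hq Z hZ).closure_subset_iff.mpr (Set.singleton_subset_iff.mpr ⟨z, hz, rfl⟩)
      ((IsLocalRing.specializes_closedPoint (q z)).mem_closure)
  obtain ⟨y, hyZ, hy⟩ := hmem
  exact ⟨y, hyZ, hy⟩

/-! ## (R3) proper + closed immersion on the special fibre ⇒ closed immersion / isomorphism -/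

section localBase

variable {O : CommRingCat.{u}} [IsLocalRing O] (q : Y ⟶ Spec O)

/-- **(R3) `isClosedImmersion_of_isClosedImmersion_specialFibre`, point + ring form.** `q : Y ⟶ Spec O` universally
closed, `O` local, `ϖ₀ ∈ 𝔪_O`; `f : X ⟶ Y` proper; (points) `f` has subsingleton fibres over every point of `Y` over the
closed point; (rings) on an affine cover `V i` of `Y`, every section of `X` over `f⁻¹(V i)` is `f♯ b + f♯(q♯ϖ₀|) · c`.
Then `f` is a closed immersion. (Finite by `isFinite_of_isProper_of_subsingleton_fibres`; then part 5's
`isClosedImmersion_of_isFinite_of_iSup_eq_top` with the cover hypothesis discharged by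
`exists_mem_not_mem_basicOpen_of_universallyClosed`.) [folklore] -/
theorem isClosedImmersion_of_isProper_of_specialFibre [UniversallyClosed q] (ϖ₀ : O)
    (hϖ₀ : ϖ₀ ∈ IsLocalRing.maximalIdeal O) [IsProper f]
    (hfib : ∀ y : Y, q y = IsLocalRing.closedPoint O → (f ⁻¹' {y}).Subsingleton)
    {ι : Type*} (V : ι → Y.Opens) (hV : ∀ i, IsAffineOpen (V i)) (hcov : ⨆ i, V i = ⊤)
    (hsurj : ∀ i, ∀ a : Γ(X, f ⁻¹ᵁ V i), ∃ b : Γ(Y, V i), ∃ c : Γ(X, f ⁻¹ᵁ V i),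
      a = f.app (V i) b +
        f.app (V i) (Y.presheaf.map (homOfLE le_top).op (q.appTop ((Scheme.ΓSpecIso O).inv ϖ₀))) * c) :
    IsClosedImmersion f := by
  haveI : IsFinite f :=
    isFinite_of_isProper_of_subsingleton_fibres f {y | q y = IsLocalRing.closedPoint O}
      (fun Z hZ hne => exists_mem_apply_eq_closedPoint_of_isClosedMap q q.isClosedMap Z hZ hne) hfib
  exact isClosedImmersion_of_isFinite_of_iSup_eq_top f V hV hcov _ hsurj
    (exists_mem_not_mem_basicOpen_of_universallyClosed q ϖ₀ hϖ₀)

/-- **(R3), isomorphism form.** As above plus injectivity of `f♯` on the `V i` (`f` schematically dominant — e.g. `X → `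
scheme-theoretic image, Mathlib `Scheme.Hom.toImage_app_injective`) `⇒` `f` is an isomorphism. [folklore] -/
theorem isIso_of_isProper_of_specialFibre [UniversallyClosed q] (ϖ₀ : O)
    (hϖ₀ : ϖ₀ ∈ IsLocalRing.maximalIdeal O) [IsProper f]
    (hfib : ∀ y : Y, q y = IsLocalRing.closedPoint O → (f ⁻¹' {y}).Subsingleton)
    {ι : Type*} (V : ι → Y.Opens) (hV : ∀ i, IsAffineOpen (V i)) (hcov : ⨆ i, V i = ⊤)
    (hinj : ∀ i, Function.Injective (f.app (V i)).hom)
    (hsurj : ∀ i, ∀ a : Γ(X, f ⁻¹ᵁ V i), ∃ b : Γ(Y, V i), ∃ c : Γ(X, f ⁻¹ᵁ V i),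
      a = f.app (V i) b +
        f.app (V i) (Y.presheaf.map (homOfLE le_top).op (q.appTop ((Scheme.ΓSpecIso O).inv ϖ₀))) * c) :
    IsIso f := by
  haveI : IsFinite f :=
    isFinite_of_isProper_of_subsingleton_fibres f {y | q y = IsLocalRing.closedPoint O}
      (fun Z hZ hne => exists_mem_apply_eq_closedPoint_of_isClosedMap q q.isClosedMap Z hZ hne) hfib
  exact isIso_of_isFinite_of_universallyClosed_of_iSup_eq_top f q ϖ₀ hϖ₀ V hV hcov hinj hsurj

/-- **(R3) with the ORDER's hypotheses «`X` and `Y` proper over `Spec O`»**: `f ≫ q` proper and `q` proper (separated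
suffices for `IsProper f`, Mathlib `IsProper.of_comp`) — closed-immersion form. [folklore] -/
theorem isClosedImmersion_of_isProper_comp_of_specialFibre [IsProper q] [IsProper (f ≫ q)] (ϖ₀ : O)
    (hϖ₀ : ϖ₀ ∈ IsLocalRing.maximalIdeal O)
    (hfib : ∀ y : Y, q y = IsLocalRing.closedPoint O → (f ⁻¹' {y}).Subsingleton)
    {ι : Type*} (V : ι → Y.Opens) (hV : ∀ i, IsAffineOpen (V i)) (hcov : ⨆ i, V i = ⊤)
    (hsurj : ∀ i, ∀ a : Γ(X, f ⁻¹ᵁ V i), ∃ b : Γ(Y, V i), ∃ c : Γ(X, f ⁻¹ᵁ V i),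
      a = f.app (V i) b +
        f.app (V i) (Y.presheaf.map (homOfLE le_top).op (q.appTop ((Scheme.ΓSpecIso O).inv ϖ₀))) * c) :
    IsClosedImmersion f := by
  haveI : IsProper f := IsProper.of_comp f q
  exact isClosedImmersion_of_isProper_of_specialFibre f q ϖ₀ hϖ₀ hfib V hV hcov hsurj

/-- **(R3) with the ORDER's hypotheses «`X` and `Y` proper over `Spec O`»** — isomorphism form. [folklore] -/
theorem isIso_of_isProper_comp_of_specialFibre [IsProper q] [IsProper (f ≫ q)] (ϖ₀ : O)
    (hϖ₀ : ϖ₀ ∈ IsLocalRing.maximalIdeal O)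
    (hfib : ∀ y : Y, q y = IsLocalRing.closedPoint O → (f ⁻¹' {y}).Subsingleton)
    {ι : Type*} (V : ι → Y.Opens) (hV : ∀ i, IsAffineOpen (V i)) (hcov : ⨆ i, V i = ⊤)
    (hinj : ∀ i, Function.Injective (f.app (V i)).hom)
    (hsurj : ∀ i, ∀ a : Γ(X, f ⁻¹ᵁ V i), ∃ b : Γ(Y, V i), ∃ c : Γ(X, f ⁻¹ᵁ V i),
      a = f.app (V i) b +
        f.app (V i) (Y.presheaf.map (homOfLE le_top).op (q.appTop ((Scheme.ΓSpecIso O).inv ϖ₀))) * c) :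
    IsIso f := by
  haveI : IsProper f := IsProper.of_comp f q
  exact isIso_of_isProper_of_specialFibre f q ϖ₀ hϖ₀ hfib V hV hcov hinj hsurj

end localBase

end Summit.ResolutionOfSingularities.ResolutionOfSingularities.Cruxes.EquisingularLiftNat.Sections
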